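import Mathlib.Analysis.SpecialFunctions.Pow.Real

/-!
# Negative knowledge for the crux `TwohalfdNeg` (stmt-AnomalousDissipation-0211), VII: the balance class is sharp at
# Alexakis–Doering's `Z ~ ν^{-1/2}` for every force with two Stokes shells

Barrier record for crux ideation / triage (D-0021), lead c10, 2026-08-17.  Every velocity-side tool the round-1 lines of
0211 lean on (Alexakis–Doering, Doering–Foias, shell defect / band pincer, Tran–Shepherd, Fjørtoft bookkeeping) uses only
the **balance class** of a steadily forced planar Leray–Hopf family: writing `ea, eb` for the long-time mean energies
carried on the two forced Stokes shells (eigenvalues `λa < λb`, force shell norms `‖g_a‖² = Ga`, `‖g_b‖² = Gb`), `eX` for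
the mean energy at a passive level `Λ ≥ λb`, and `A = ⟨(g_a, v)⟩`, `B = ⟨(g_b, v)⟩` for the mean works of the two shells,
the class consists of
* the energy ceiling `ea + eb + eX ≤ E`,
* per-shell Cauchy–Schwarz `A² ≤ Ga·ea`, `B² ≤ Gb·eb`,
* the mean energy balance `(g, v) = ν Z`, `Z = λa ea + λb eb + Λ eX` (enstrophy),
* the mean enstrophy balance `(−Δg, v) = ν P`, `P = λa² ea + λb² eb + Λ² eX` (palinstrophy).
`balanceClass_twoShell_sharp` shows that these constraints admit, for EVERY passive level `Λ` with `ν Λ² ≤ c`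
(`c = c(λa, λb, Ga, Gb, E) > 0` explicit), a pseudo-state carrying half of the energy budget at level `Λ`, hence with
enstrophy `Z ≥ Λ E / 2`; `balanceClass_twoShell_enstrophy_inv_sqrt` takes `Λ = (c/ν)^{1/2}`: enstrophy `(E/2)(c/ν)^{1/2}`
is balance-class admissible, i.e. the interpolation bound `Z ≲ ν^{-1/2}` (Alexakis–Doering 2006 §2, tree
`Literature.Barriers.AnomalousDissipation.AlexakisDoering2006_energyDissipationBound`) cannot be improved inside the class,
let alone to the `o(log²(1/ν))` that the residual stub `SubLogStrain` of every round-1 line needs.  (With ONE forced shell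
the same two balances force `P = λ Z` and bounded enstrophy — the landed single-shell theorem; the second shell is exactly
what frees `Z`.)  Pure real arithmetic; no Navier–Stokes object is constructed, which is the point: a proof of
`SubLogStrain` must use an input outside this class.  Supports stmt-AnomalousDissipation-0211
(`Cruxes/TwohalfdNeg/Lines/log-kantorovich-enstrophy-transfer_dead.md` §2).
-/

noncomputable section

namespace Summit.AnomalousDissipation.AnomalousDissipation.Theorems.TwohalfdNeg.Negative

section BalanceClassBarrier

/-- **The two balances as a linear system for the shell works.**  For `λa ≠ λb` the works
`A = ν(λb Z − P)/(λb − λa)`, `B = ν(P − λa Z)/(λb − λa)` solve `A + B = νZ` (energy balance) and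
`λa A + λb B = νP` (enstrophy balance). [folklore] -/
theorem shellWorks_solve_balances {la lb : ℝ} (hab : la ≠ lb) (ν Z P : ℝ) :
    ν * (lb * Z - P) / (lb - la) + ν * (P - la * Z) / (lb - la) = ν * Z ∧
      la * (ν * (lb * Z - P) / (lb - la)) + lb * (ν * (P - la * Z) / (lb - la)) = ν * P := by
  have hd : lb - la ≠ 0 := sub_ne_zero.mpr (Ne.symm hab)
  constructor
  · rw [← add_div, div_eq_iff hd]; ring
  · rw [mul_div_assoc', mul_div_assoc', ← add_div, div_eq_iff hd]; ring

/-- **Size of the shell works of a pseudo-state whose levels lie below `Λ`.**  If `0 ≤ Z ≤ Λ T` and `0 ≤ P ≤ Λ² T`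
with `0 < λa < λb ≤ Λ`, then both works are at most `2 ν Λ² T/(λb − λa)` in absolute value. [folklore] -/
theorem abs_shellWorks_le {la lb Λ ν Z P T : ℝ} (hla : 0 < la) (hab : la < lb) (hΛ : lb ≤ Λ) (hν : 0 ≤ ν)
    (hZ0 : 0 ≤ Z) (hZ : Z ≤ Λ * T) (hP0 : 0 ≤ P) (hP : P ≤ Λ ^ 2 * T) :
    |ν * (lb * Z - P) / (lb - la)| ≤ 2 * ν * Λ ^ 2 * T / (lb - la) ∧
      |ν * (P - la * Z) / (lb - la)| ≤ 2 * ν * Λ ^ 2 * T / (lb - la) := by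
  have hd : 0 < lb - la := sub_pos.mpr hab
  have hΛ0 : 0 < Λ := lt_of_lt_of_le (hla.trans hab) hΛ
  have hlbZ : lb * Z ≤ Λ ^ 2 * T := by
    calc lb * Z ≤ Λ * (Λ * T) := mul_le_mul hΛ hZ hZ0 hΛ0.le
      _ = Λ ^ 2 * T := by ring
  have hlaZ : la * Z ≤ Λ ^ 2 * T := by
    calc la * Z ≤ Λ * (Λ * T) := mul_le_mul (hab.le.trans hΛ) hZ hZ0 hΛ0.le
      _ = Λ ^ 2 * T := by ring
  have hlaZ0 : 0 ≤ la * Z := mul_nonneg hla.le hZ0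
  have hlbZ0 : 0 ≤ lb * Z := mul_nonneg (hla.trans hab).le hZ0
  have h1 : |lb * Z - P| ≤ 2 * Λ ^ 2 * T := by
    rw [abs_le]; constructor <;> linarith
  have h2 : |P - la * Z| ≤ 2 * Λ ^ 2 * T := by
    rw [abs_le]; constructor <;> linarith
  constructor
  · rw [abs_div, abs_of_pos hd, div_le_div_iff_of_pos_right hd, abs_mul, abs_of_nonneg hν]
    calc ν * |lb * Z - P| ≤ ν * (2 * Λ ^ 2 * T) := mul_le_mul_of_nonneg_left h1 hν
      _ = 2 * ν * Λ ^ 2 * T := by ring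
  · rw [abs_div, abs_of_pos hd, div_le_div_iff_of_pos_right hd, abs_mul, abs_of_nonneg hν]
    calc ν * |P - la * Z| ≤ ν * (2 * Λ ^ 2 * T) := mul_le_mul_of_nonneg_left h2 hν
      _ = 2 * ν * Λ ^ 2 * T := by ring

/-- **The balance class is sharp for two forced shells.**  For Stokes eigenvalues `0 < λa < λb`, force shell norms
`Ga, Gb > 0` and an energy ceiling `E > 0` there is an explicit `c > 0` such that for every viscosity `ν > 0` and every
passive level `Λ ≥ λb` with `ν Λ² ≤ c` the balance class (energy ceiling, per-shell Cauchy–Schwarz, mean energy balance,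
mean enstrophy balance) contains a pseudo-state with half of the energy at level `Λ` — hence enstrophy
`Z = λa ea + λb eb + Λ eX ≥ Λ E/2`.  Witness: `ea = eb = E/4`, `eX = E/2`, works from `shellWorks_solve_balances`.
[folklore] -/
theorem balanceClass_twoShell_sharp {la lb Ga Gb E : ℝ} (hla : 0 < la) (hab : la < lb) (hGa : 0 < Ga)
    (hGb : 0 < Gb) (hE : 0 < E) :
    ∃ c : ℝ, 0 < c ∧ ∀ ν Λ : ℝ, 0 < ν → lb ≤ Λ → ν * Λ ^ 2 ≤ c →
      ∃ A B ea eb eX : ℝ,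
        0 ≤ ea ∧ 0 ≤ eb ∧ 0 ≤ eX ∧ ea + eb + eX ≤ E ∧
        A ^ 2 ≤ Ga * ea ∧ B ^ 2 ≤ Gb * eb ∧
        A + B = ν * (la * ea + lb * eb + Λ * eX) ∧
        la * A + lb * B = ν * (la ^ 2 * ea + lb ^ 2 * eb + Λ ^ 2 * eX) ∧
        E / 2 ≤ eX ∧ Λ * E / 2 ≤ la * ea + lb * eb + Λ * eX := by
  have hd : 0 < lb - la := sub_pos.mpr hab
  have hlb : 0 < lb := hla.trans hab
  -- the smallness constant: `c ≤ 1`, `c ≤ Ga (λb-λa)²/(16 E)`, `c ≤ Gb (λb-λa)²/(16 E)`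
  obtain ⟨Ka, hKa⟩ : ∃ Ka : ℝ, Ka = Ga * (lb - la) ^ 2 / (16 * E) := ⟨_, rfl⟩
  obtain ⟨Kb, hKb⟩ : ∃ Kb : ℝ, Kb = Gb * (lb - la) ^ 2 / (16 * E) := ⟨_, rfl⟩
  have hd2 : 0 < (lb - la) ^ 2 := pow_pos hd 2
  have hKa0 : 0 < Ka := by rw [hKa]; exact div_pos (mul_pos hGa hd2) (by positivity)
  have hKb0 : 0 < Kb := by rw [hKb]; exact div_pos (mul_pos hGb hd2) (by positivity)
  refine ⟨min 1 (min Ka Kb), lt_min one_pos (lt_min hKa0 hKb0), ?_⟩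
  intro ν Λ hν hΛ hc
  have hc1 : ν * Λ ^ 2 ≤ 1 := hc.trans (min_le_left _ _)
  have hca : ν * Λ ^ 2 ≤ Ka := hc.trans ((min_le_right _ _).trans (min_le_left _ _))
  have hcb : ν * Λ ^ 2 ≤ Kb := hc.trans ((min_le_right _ _).trans (min_le_right _ _))
  have hΛ0 : 0 < Λ := lt_of_lt_of_le (hla.trans hab) hΛ
  have hx0 : 0 ≤ ν * Λ ^ 2 := mul_nonneg hν.le (sq_nonneg Λ)
  have hlaΛ : la ≤ Λ := hab.le.trans hΛ
  -- the witness levels: `E/4` on each forced shell, `E/2` at the passive level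
  obtain ⟨Z, hZdef⟩ : ∃ Z : ℝ, Z = la * (E / 4) + lb * (E / 4) + Λ * (E / 2) := ⟨_, rfl⟩
  obtain ⟨P, hPdef⟩ : ∃ P : ℝ, P = la ^ 2 * (E / 4) + lb ^ 2 * (E / 4) + Λ ^ 2 * (E / 2) := ⟨_, rfl⟩
  have hZ0 : 0 ≤ Z := by rw [hZdef]; positivity
  have hP0 : 0 ≤ P := by rw [hPdef]; positivity
  have hZ : Z ≤ Λ * E := by
    have h1 : la * (E / 4) ≤ Λ * (E / 4) := mul_le_mul_of_nonneg_right hlaΛ (by positivity)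
    have h2 : lb * (E / 4) ≤ Λ * (E / 4) := mul_le_mul_of_nonneg_right hΛ (by positivity)
    rw [hZdef]; linarith
  have hP : P ≤ Λ ^ 2 * E := by
    have h1 : la ^ 2 * (E / 4) ≤ Λ ^ 2 * (E / 4) :=
      mul_le_mul_of_nonneg_right (pow_le_pow_left₀ hla.le hlaΛ 2) (by positivity)
    have h2 : lb ^ 2 * (E / 4) ≤ Λ ^ 2 * (E / 4) :=
      mul_le_mul_of_nonneg_right (pow_le_pow_left₀ (hla.trans hab).le hΛ 2) (by positivity)
    rw [hPdef]; linarith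
  obtain ⟨hAle, hBle⟩ := abs_shellWorks_le hla hab hΛ hν.le hZ0 hZ hP0 hP
  obtain ⟨hsum, hens⟩ := shellWorks_solve_balances hab.ne ν Z P
  -- the Cauchy–Schwarz constraints from the smallness of `ν Λ²`
  have hbound : (2 * ν * Λ ^ 2 * E / (lb - la)) ^ 2 = 4 * E ^ 2 / (lb - la) ^ 2 * (ν * Λ ^ 2) ^ 2 := by
    rw [div_pow, div_mul_eq_mul_div]
    congr 1
    ring
  have hsq : (ν * Λ ^ 2) ^ 2 ≤ ν * Λ ^ 2 := by
    calc (ν * Λ ^ 2) ^ 2 = (ν * Λ ^ 2) * (ν * Λ ^ 2) := sq _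
      _ ≤ 1 * (ν * Λ ^ 2) := mul_le_mul_of_nonneg_right hc1 hx0
      _ = ν * Λ ^ 2 := one_mul _
  have hcoef : 0 ≤ 4 * E ^ 2 / (lb - la) ^ 2 := div_nonneg (by positivity) hd2.le
  have hA2 : (ν * (lb * Z - P) / (lb - la)) ^ 2 ≤ Ga * (E / 4) := by
    have h1 : (ν * (lb * Z - P) / (lb - la)) ^ 2 ≤ (2 * ν * Λ ^ 2 * E / (lb - la)) ^ 2 := by
      rw [← sq_abs (ν * (lb * Z - P) / (lb - la))]
      exact pow_le_pow_left₀ (abs_nonneg _) hAle 2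
    have h2 : 4 * E ^ 2 / (lb - la) ^ 2 * (ν * Λ ^ 2) ^ 2 ≤ 4 * E ^ 2 / (lb - la) ^ 2 * Ka :=
      mul_le_mul_of_nonneg_left (hsq.trans hca) hcoef
    have h3 : 4 * E ^ 2 / (lb - la) ^ 2 * Ka = Ga * (E / 4) := by
      rw [hKa, div_mul_div_comm, div_eq_iff (mul_ne_zero hd2.ne' (by positivity))]
      ring
    linarith [hbound]
  have hB2 : (ν * (P - la * Z) / (lb - la)) ^ 2 ≤ Gb * (E / 4) := by
    have h1 : (ν * (P - la * Z) / (lb - la)) ^ 2 ≤ (2 * ν * Λ ^ 2 * E / (lb - la)) ^ 2 := by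
      rw [← sq_abs (ν * (P - la * Z) / (lb - la))]
      exact pow_le_pow_left₀ (abs_nonneg _) hBle 2
    have h2 : 4 * E ^ 2 / (lb - la) ^ 2 * (ν * Λ ^ 2) ^ 2 ≤ 4 * E ^ 2 / (lb - la) ^ 2 * Kb :=
      mul_le_mul_of_nonneg_left (hsq.trans hcb) hcoef
    have h3 : 4 * E ^ 2 / (lb - la) ^ 2 * Kb = Gb * (E / 4) := by
      rw [hKb, div_mul_div_comm, div_eq_iff (mul_ne_zero hd2.ne' (by positivity))]
      ring
    linarith [hbound]
  refine ⟨ν * (lb * Z - P) / (lb - la), ν * (P - la * Z) / (lb - la), E / 4, E / 4, E / 2,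
    by positivity, by positivity, by positivity, by linarith, hA2, hB2, ?_, ?_, le_rfl, ?_⟩
  · rw [hsum, hZdef]
  · rw [hens, hPdef]
  · have : 0 ≤ la * (E / 4) + lb * (E / 4) :=
      add_nonneg (mul_nonneg hla.le (by positivity)) (mul_nonneg hlb.le (by positivity))
    linarith

/-- **Corollary: enstrophy of order `ν^{-1/2}` is balance-class admissible** (Alexakis–Doering's `Z ≲ ν^{-1/2}` is sharp
inside the class).  With `c` from `balanceClass_twoShell_sharp`, for every `0 < ν ≤ c/λb²` the passive level
`Λ = (c/ν)^{1/2} ≥ λb` is admissible, giving a pseudo-state with `Z ≥ (E/2)·(c/ν)^{1/2}`. [folklore] -/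
theorem balanceClass_twoShell_enstrophy_inv_sqrt {la lb Ga Gb E : ℝ} (hla : 0 < la) (hab : la < lb)
    (hGa : 0 < Ga) (hGb : 0 < Gb) (hE : 0 < E) :
    ∃ c : ℝ, 0 < c ∧ ∀ ν : ℝ, 0 < ν → ν ≤ c / lb ^ 2 →
      ∃ Λ A B ea eb eX : ℝ, lb ≤ Λ ∧
        0 ≤ ea ∧ 0 ≤ eb ∧ 0 ≤ eX ∧ ea + eb + eX ≤ E ∧
        A ^ 2 ≤ Ga * ea ∧ B ^ 2 ≤ Gb * eb ∧
        A + B = ν * (la * ea + lb * eb + Λ * eX) ∧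
        la * A + lb * B = ν * (la ^ 2 * ea + lb ^ 2 * eb + Λ ^ 2 * eX) ∧
        E / 2 * Real.sqrt (c / ν) ≤ la * ea + lb * eb + Λ * eX := by
  obtain ⟨c, hc, H⟩ := balanceClass_twoShell_sharp hla hab hGa hGb hE
  refine ⟨c, hc, fun ν hν hνc => ?_⟩
  have hlb : 0 < lb := hla.trans hab
  have hcν : 0 ≤ c / ν := div_nonneg hc.le hν.le
  have hΛsq : Real.sqrt (c / ν) ^ 2 = c / ν := Real.sq_sqrt hcν
  have hνΛ : ν * Real.sqrt (c / ν) ^ 2 ≤ c := by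
    rw [hΛsq, mul_div_assoc', mul_div_cancel_left₀ _ hν.ne']
  have hΛ : lb ≤ Real.sqrt (c / ν) := by
    rw [Real.le_sqrt' hlb, le_div_iff₀ hν]
    calc lb ^ 2 * ν ≤ lb ^ 2 * (c / lb ^ 2) := mul_le_mul_of_nonneg_left hνc (sq_nonneg lb)
      _ = c := by rw [mul_div_assoc', mul_div_cancel_left₀ _ (pow_pos hlb 2).ne']
  obtain ⟨A, B, ea, eb, eX, h0a, h0b, h0X, hEn, hA, hB, hsum, hens, -, hZ⟩ := H ν _ hν hΛ hνΛ
  refine ⟨Real.sqrt (c / ν), A, B, ea, eb, eX, hΛ, h0a, h0b, h0X, hEn, hA, hB, hsum, hens, ?_⟩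
  calc E / 2 * Real.sqrt (c / ν) = Real.sqrt (c / ν) * E / 2 := by ring
    _ ≤ la * ea + lb * eb + Real.sqrt (c / ν) * eX := hZ

end BalanceClassBarrier

end Summit.AnomalousDissipation.AnomalousDissipation.Theorems.TwohalfdNeg.Negative
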